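import Summits.QuantumFields.BalabanUV.Beta.GAN24.FibreArrow
import Summits.QuantumFields.BalabanUV.Beta.GAN24.FibreGaffney
import Summits.QuantumFields.BalabanUV.Beta.GAN24.CapacitanceSolveZero
import Literature.MathematicalPhysics.QuantumFieldTheory.Balaban1983to89.B4ContourShift

/-!
# `BalabanUV.Beta.GAN24.FibreArrowBZ` — binder row G-an2-4 / (CONV-C), road P1-fibre (leaves P1-L04c / P1-L05, glue): the alias fibre on the REAL ZONE
# `BZ = [−π, π]^D` — unitary character, all aliases off the zero mode for `p ≠ 0` — and the `p = 0` fibre as leaf-15's `Fibre0` arrow system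

NOT IN PRINT; OUR PROOF ATTEMPT.  HONEST FRAMING (cell contract, verbatim): «discharging `BetaPertH` makes Bałaban's UV stability UNCONDITIONAL — a real
constructive-QFT result; it is NOT the continuum limit and NOT the Clay problem.»  HONEST DEPENDENCY (verbatim): «continuum YM on T⁴ ⇐ BetaPertH ∧ nine spine
estimates (0/9 proved); BetaPertH ⇐ (D1) ∧ (D4) ∧ CAP+tail; G-an2-4 gates asym, D1 and NE2/3/4.»  [folklore] elementary trigonometry / finite bookkeeping over `ℂ`
(no estimate, no cited fact, no wall binder, no `def … : Prop` fact).  NOT summit progress; nothing of (CONV-C)'s K-slot is discharged here.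

## What is proved
* §1 REAL ZONE: for `p ∈ B4ContourShift.BZ D` (`|p_κ| ≤ π`) and the fine momenta `k_m = kFine (ofRealVec p) m`: `conj k_{m,κ} = k_{m,κ}` (`conj_kFine_ofRealVec`);
  `∂̂_κ(k_m) ≠ 0` as soon as `p_κ ≠ 0 ∨ m_κ ≠ 0` (`dhat_kFine_ne_zero`: `e^{ik} = 1` forces `p_κ ∈ 2πℤ`, impossible for `0 < |p_κ| ≤ π`, and `m_κ ∈ Nℤ`, impossible for
  `0 < m_κ < N`); hence **`lapSym_kFine_ne_zero`**: `L_m ≠ 0` unless `p = 0 ∧ m = 0` (leaf `FibreGaffney.lapSym_ne_zero`) — the hypothesis `hL` of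
  `FibreArrow.aliasFibre` / `Capacitance.isUnit_capMat` holds at EVERY `p ∈ BZ ∖ {0}` (`hL_of_mem_BZ`), and at `p = 0` for every alias `m ≠ 0` (`hL_zero`); the
  unitarity hypothesis `hχ` is an2's `BlochFibreMatrix.norm_blochChar_real`.
* §2 THE `p = 0` FIBRE: the zero alias has `k_0 = 0`, `∂̂ = ∂̂♭ = 0`, `L_0 = 0`, `χ̂_0 = 1`, `s♭_κ(0) = N`, `S(0) = N^D`, `(S s_κ)(0) = N^{D+1}` (`kFine_zero_zero`, `chiHat_zero_zero`,
  `sflat_zero_zero`, `boxS_zero_zero`, `boxSs_zero_zero`); the nonzero aliases form leaf-15's `CapacitanceSolveZero.Fibre0` (`aliasFibre0`, index the subtype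
  `{m // m ≠ 0}`), and **`fibreFun_zero_eq_iff_arrowSolves0`**: `fibreFun (blochChar 0) v = r ↔ ∃ c, ArrowSolves0 aliasFibre0 …` with the m = 0 rows
  `−N φ_κ = srcEL 0 r 0 κ`, `−c = srcG 0 r 0` — so leaf-15's `arrowSolves0_iff` solves the `p = 0` fibre EXPLICITLY (no capacitance inverse at all).
Unit `b2b-balaban-gan24-formalise-leaf-06` (G-an2-4 formalisation swarm), 2026-08-19.
-/

noncomputable section

open Complex Finset
open scoped BigOperators Real ComplexConjugate
open Literature.MathematicalPhysics.QuantumFieldTheory.Balaban1983to89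
open Literature.MathematicalPhysics.QuantumFieldTheory.Balaban1983to89.Beta
open Literature.MathematicalPhysics.QuantumFieldTheory.LatticeForm (repZ)
open Literature.Probability.LatticeModels (TorusSite)
open AffineAveraging (Site unitVec unitVec_apply)
open BlochFibreMatrix (Idx blochChar fibreFun repZ_zero repZ_nonneg repZ_lt)
open B4Strip (ofRealVec)
open B4ContourShift (BZ)
open Summit.QuantumFields.BalabanUV.Beta.GAN24.FibreSymbols (pw dhat dflat lapSym)
open Summit.QuantumFields.BalabanUV.Beta.GAN24.FibreBlockSolve (dot)
open Summit.QuantumFields.BalabanUV.Beta.GAN24.FibreDFT (kFine amp pw_zero_site)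
open Summit.QuantumFields.BalabanUV.Beta.GAN24.FibreDFTDictionary (ampA ampμ)
open Summit.QuantumFields.BalabanUV.Beta.GAN24.FibreArrow (chiHat sflat boxS boxSs srcEL srcG EL_iff G_iff M_iff Q_iff fibreFun_eq_iff_rows dot_dflat_dhat)
open Summit.QuantumFields.BalabanUV.Beta.GAN24.CapacitanceSolve (Fibre ELRows GRows)
open Summit.QuantumFields.BalabanUV.Beta.GAN24.CapacitanceSolveZero (Fibre0 ArrowSolves0)

namespace Summit.QuantumFields.BalabanUV.Beta.GAN24.FibreArrowBZ

variable {D N : ℕ} [NeZero N]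

/-! ## §1 The real zone: realness of the fine momenta and `L_m ≠ 0` off `(p, m) = (0, 0)` -/

omit [NeZero N] in
/-- [folklore] The fine momentum of a real quasi-momentum is real: `k_{m,κ} = ((p_κ + 2π m_κ)/N : ℝ)`. -/
theorem kFine_ofRealVec_apply (p : Fin D → ℝ) (m : TorusSite D N) (κ : Fin D) :
    kFine (ofRealVec p) m κ = (((p κ + 2 * π * (repZ m κ : ℝ)) / N : ℝ) : ℂ) := by
  simp only [kFine, ofRealVec]
  push_cast
  ring

omit [NeZero N] in
/-- [folklore] … hence self-conjugate. -/
theorem conj_kFine_ofRealVec (p : Fin D → ℝ) (m : TorusSite D N) (κ : Fin D) :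
    conj (kFine (ofRealVec p) m κ) = kFine (ofRealVec p) m κ := by
  rw [kFine_ofRealVec_apply, Complex.conj_ofReal]

/-- [folklore] **`∂̂_κ(k_m) ≠ 0` on the real zone** as soon as `p_κ ≠ 0` or `m_κ ≠ 0` (`|p_κ| ≤ π`): `e^{i k_{m,κ}} = 1` would force `p_κ + 2π m_κ ∈ 2πNℤ`. -/
theorem dhat_kFine_ne_zero {p : Fin D → ℝ} {κ : Fin D} (hp : |p κ| ≤ π) (m : TorusSite D N) (h : p κ ≠ 0 ∨ m κ ≠ 0) :
    dhat (kFine (ofRealVec p) m) κ ≠ 0 := by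
  intro h0
  have h1 : cexp (I * kFine (ofRealVec p) m κ) = 1 := by
    have : dhat (kFine (ofRealVec p) m) κ = cexp (I * kFine (ofRealVec p) m κ) - 1 := rfl
    rw [this] at h0
    exact sub_eq_zero.mp h0
  obtain ⟨n, hn⟩ := Complex.exp_eq_one_iff.mp h1
  rw [kFine_ofRealVec_apply] at hn
  -- compare: I * x = n * (2π I) with x real ⇒ x = 2π n
  have hx : ((p κ + 2 * π * (repZ m κ : ℝ)) / N : ℝ) = 2 * π * n := by
    have h2 : (( ((p κ + 2 * π * (repZ m κ : ℝ)) / N : ℝ) : ℂ)) = ((2 * π * n : ℝ) : ℂ) := by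
      have hI : (I : ℂ) ≠ 0 := Complex.I_ne_zero
      have := hn
      push_cast at this ⊢
      have h3 : I * (↑(p κ) + 2 * ↑π * ↑(repZ m κ)) / ↑N * 1 = I * (2 * ↑π * ↑n) := by
        rw [mul_one]; linear_combination this
      have h4 := mul_left_cancel₀ hI (by simpa [mul_div_assoc] using h3)
      exact h4
    exact_mod_cast h2
  have hN : (0 : ℝ) < N := by exact_mod_cast Nat.pos_of_ne_zero (NeZero.ne N)
  have hx' : p κ = 2 * π * ((n * N - repZ m κ : ℤ) : ℝ) := by
    field_simp at hx
    push_cast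
    linarith
  -- integer `j := n N − m_κ`; `p_κ = 2π j` with `|p_κ| ≤ π` forces `j = 0`
  set j : ℤ := n * N - repZ m κ with hj
  have hj0 : j = 0 := by
    by_contra hne
    have h1le : (1 : ℝ) ≤ |(j : ℝ)| := by
      rw [← Int.cast_abs]; exact_mod_cast Int.one_le_abs hne
    have : |p κ| = 2 * π * |(j : ℝ)| := by
      rw [hx', abs_mul, abs_of_pos (by positivity : (0:ℝ) < 2 * π)]
    have hπ : 2 * π * 1 ≤ |p κ| := by rw [this]; exact mul_le_mul_of_nonneg_left h1le (by positivity)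
    linarith [Real.pi_pos]
  rcases h with hp0 | hm0
  · apply hp0
    rw [hx', hj0]; simp
  · -- `m_κ = n N` with `0 ≤ m_κ < N` forces `m_κ = 0`
    have hmk : (repZ m κ : ℤ) = n * N := by linarith [show (j : ℤ) = 0 from hj0]
    have h0le : (0 : ℤ) ≤ repZ m κ := repZ_nonneg m κ
    have hlt : (repZ m κ : ℤ) < N := repZ_lt m κ
    have hn0 : n = 0 := by
      by_contra hne
      rcases lt_or_gt_of_ne hne with hneg | hpos
      · have : (n : ℤ) * N ≤ -1 * N := by nlinarith
        linarith
      · have : (1 : ℤ) * N ≤ n * N := by nlinarith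
        linarith
    rw [hn0, zero_mul] at hmk
    apply hm0
    have : ((m κ).val : ℤ) = 0 := hmk
    have hv : (m κ).val = 0 := by exact_mod_cast this
    exact (ZMod.val_eq_zero _).mp hv

/-- [folklore] **`L_m ≠ 0` ON THE REAL ZONE unless `(p, m) = (0, 0)`.** -/
theorem lapSym_kFine_ne_zero {p : Fin D → ℝ} (hp : p ∈ BZ D) (m : TorusSite D N) (h : p ≠ 0 ∨ m ≠ 0) :
    lapSym (kFine (ofRealVec p) m) ≠ 0 := by
  have hpκ : ∀ κ, |p κ| ≤ π := fun κ => abs_le.mpr ⟨hp.1 κ, hp.2 κ⟩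
  have hκ : ∃ κ, p κ ≠ 0 ∨ m κ ≠ 0 := by
    rcases h with h | h
    · obtain ⟨κ, hκ⟩ := Function.ne_iff.mp h
      exact ⟨κ, Or.inl hκ⟩
    · obtain ⟨κ, hκ⟩ := Function.ne_iff.mp h
      exact ⟨κ, Or.inr hκ⟩
  obtain ⟨κ, hκ⟩ := hκ
  exact FibreGaffney.lapSym_ne_zero (conj_kFine_ofRealVec p m) (dhat_kFine_ne_zero (hpκ κ) m hκ)

/-- [folklore] The hypothesis `hL` of `FibreArrow.aliasFibre` at every nonzero real-zone momentum. -/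
theorem hL_of_mem_BZ {p : Fin D → ℝ} (hp : p ∈ BZ D) (hp0 : p ≠ 0) (m : TorusSite D N) : lapSym (kFine (ofRealVec p) m) ≠ 0 :=
  lapSym_kFine_ne_zero hp m (Or.inl hp0)

omit [NeZero N] in
/-- [folklore] `ofRealVec 0 = 0`. -/
theorem ofRealVec_zero : ofRealVec (0 : Fin D → ℝ) = 0 := by
  funext μ; simp [ofRealVec]

omit [NeZero N] in
/-- [folklore] `0 ∈ BZ`. -/
theorem zero_mem_BZ : (0 : Fin D → ℝ) ∈ BZ D :=
  ⟨fun _ => by simpa using Real.pi_pos.le, fun _ => Real.pi_pos.le⟩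

/-- [folklore] At `p = 0` every NONZERO alias is off the zero mode. -/
theorem hL_zero {m : TorusSite D N} (hm : m ≠ 0) : lapSym (kFine (0 : Fin D → ℂ) m) ≠ 0 := by
  have h := lapSym_kFine_ne_zero (N := N) zero_mem_BZ m (Or.inr hm)
  rwa [ofRealVec_zero] at h

/-! ## §2 The `p = 0` fibre: the zero alias and leaf-15's `Fibre0` -/

omit [NeZero N] in
/-- [folklore] The zero alias at `p = 0` sits at momentum `0`. -/
theorem kFine_zero_zero : kFine (0 : Fin D → ℂ) (0 : TorusSite D N) = 0 := by
  funext μ; simp [kFine, repZ_zero]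

omit [NeZero N] in
/-- [folklore] `∂̂(0) = 0`. -/
theorem dhat_zero (κ : Fin D) : dhat (0 : Fin D → ℂ) κ = 0 := by simp [dhat]

omit [NeZero N] in
/-- [folklore] `∂̂♭(0) = 0`. -/
theorem dflat_zero (κ : Fin D) : dflat (0 : Fin D → ℂ) κ = 0 := by simp [dflat]

omit [NeZero N] in
/-- [folklore] `L(0) = 0`. -/
theorem lapSym_zero : lapSym (0 : Fin D → ℂ) = 0 := by simp [lapSym, dhat_zero]

omit [NeZero N] in
/-- [folklore] `pw 0 ≡ 1`. -/
theorem pw_zero_mom (x : Site D) : pw (0 : Fin D → ℂ) x = 1 := by simp [pw]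

/-- [folklore] `|(ℤ/N)^D| = N^D` as a complex number. -/
theorem sum_one_torus : ∑ _z : TorusSite D N, (1 : ℂ) = (N : ℂ) ^ D := by
  rw [Finset.sum_const, Finset.card_univ, nsmul_eq_mul, mul_one]
  simp [Fintype.card_pi, ZMod.card]

/-- [folklore] `χ̂_0 = 1` at `p = 0`. -/
theorem chiHat_zero_zero : chiHat (0 : Fin D → ℂ) (0 : TorusSite D N) = 1 := by
  unfold chiHat amp
  rw [kFine_zero_zero, neg_zero]
  simp only [Pi.one_apply, pw_zero_mom, one_mul, sum_one_torus]
  exact inv_mul_cancel₀ (pow_ne_zero _ (Nat.cast_ne_zero.2 (NeZero.ne N)))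

omit [NeZero N] in
/-- [folklore] `s♭_κ(0) = N` at `p = 0`. -/
theorem sflat_zero_zero (κ : Fin D) : sflat (0 : Fin D → ℂ) (0 : TorusSite D N) κ = N := by
  unfold sflat
  rw [kFine_zero_zero, neg_zero]
  simp [pw_zero_mom]

/-- [folklore] `S(0) = N^D` at `p = 0`. -/
theorem boxS_zero_zero : boxS (0 : Fin D → ℂ) (0 : TorusSite D N) = (N : ℂ) ^ D := by
  unfold boxS
  rw [kFine_zero_zero]
  simp only [pw_zero_mom, sum_one_torus]

/-- [folklore] `(S s_κ)(0) = N^{D+1}` at `p = 0`. -/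
theorem boxSs_zero_zero (κ : Fin D) : boxSs (0 : Fin D → ℂ) (0 : TorusSite D N) κ = (N : ℂ) ^ (D + 1) := by
  unfold boxSs
  rw [kFine_zero_zero]
  have h1 : ∀ z : TorusSite D N, ∑ s ∈ Finset.range N, pw (0 : Fin D → ℂ) (repZ z + (s : ℤ) • unitVec κ) = (N : ℂ) := by
    intro z; simp [pw_zero_mom]
  rw [Finset.sum_congr rfl fun z _ => h1 z, Finset.sum_const, Finset.card_univ, nsmul_eq_mul, pow_succ]
  congr 1
  simp [Fintype.card_pi, ZMod.card]

/-- [folklore] THE `p = 0` ALIAS FIBRE DATA (leaf-15's `Fibre0`): the nonzero aliases `{m // m ≠ 0}` with the symbols/borders of `FibreArrow.aliasFibre` at `p = 0`,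
plus the zero-alias border weights `wE⁰ = N`, `wG⁰ = 1`, `wM⁰ = N^D`, `wQ⁰ = N^{D+1}` (all nonzero). -/
def aliasFibre0 : Fibre0 D {m : TorusSite D N // m ≠ 0} where
  dd m := dhat (kFine (0 : Fin D → ℂ) m.1)
  db m := dflat (kFine (0 : Fin D → ℂ) m.1)
  L m := lapSym (kFine (0 : Fin D → ℂ) m.1)
  wE m κ := chiHat 0 m.1 * sflat 0 m.1 κ
  wG m := chiHat 0 m.1
  wM m := boxS 0 m.1
  wQ m κ := boxSs 0 m.1 κ
  L_ne m := hL_zero m.2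
  dot_db_dd m := dot_dflat_dhat (kFine 0 m.1)
  wE0 _ := N
  wG0 := 1
  wM0 := (N : ℂ) ^ D
  wQ0 _ := (N : ℂ) ^ (D + 1)
  wE0_ne _ := Nat.cast_ne_zero.2 (NeZero.ne N)
  wG0_ne := one_ne_zero
  wM0_ne := pow_ne_zero _ (Nat.cast_ne_zero.2 (NeZero.ne N))
  wQ0_ne _ := pow_ne_zero _ (Nat.cast_ne_zero.2 (NeZero.ne N))

omit [NeZero N] in
/-- [folklore] `∀ m` over the alias lattice = the zero alias and the nonzero ones. -/
theorem forall_torus_iff {P : TorusSite D N → Prop} : (∀ m, P m) ↔ P 0 ∧ ∀ m : {m : TorusSite D N // m ≠ 0}, P m.1 := by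
  constructor
  · exact fun h => ⟨h 0, fun m => h m.1⟩
  · rintro ⟨h0, h⟩ m
    by_cases hm : m = 0
    · subst hm; exact h0
    · exact h ⟨m, hm⟩

/-- [folklore] `Σ_m` over the alias lattice = the zero alias + the nonzero ones. -/
theorem sum_torus_eq (f : TorusSite D N → ℂ) : ∑ m, f m = f 0 + ∑ m : {m : TorusSite D N // m ≠ 0}, f m.1 := by
  rw [← Finset.add_sum_erase _ _ (Finset.mem_univ (0 : TorusSite D N))]
  congr 1
  exact Finset.sum_subtype _ (fun m => by simp) f

/-- [folklore] **THE `p = 0` FIBRE SYSTEM IS LEAF-15's `ArrowSolves0`.**  With `Â = ampA 0 v`, `μ̂ = ampμ 0 v`, `φ = v∘inr∘inr`: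
`fibreFun (blochChar 0) v = r ↔ ∃ c, ArrowSolves0 aliasFibre0 (srcEL|_{m≠0}) (srcG|_{m≠0}) (srcEL 0 r 0) (srcG 0 r 0) r_M r_Q (Â|_{m≠0}) (μ̂|_{m≠0}) (Â 0) (μ̂ 0) φ c`
— then `CapacitanceSolveZero.arrowSolves0_iff` gives the solution in closed form. -/
theorem fibreFun_zero_eq_iff_arrowSolves0 (v r : Idx D N → ℂ) :
    fibreFun (⇑(blochChar (0 : Fin D → ℂ))) v = r ↔
      ∃ c : ℂ, ArrowSolves0 (aliasFibre0 (D := D) (N := N))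
        (fun m => srcEL (0 : Fin D → ℂ) r m.1) (fun m => srcG (0 : Fin D → ℂ) r m.1)
        (fun κ => srcEL (0 : Fin D → ℂ) r (0 : TorusSite D N) κ) (srcG (0 : Fin D → ℂ) r (0 : TorusSite D N))
        (r (Sum.inr (Sum.inl 0))) (fun κ => r (Sum.inr (Sum.inr κ)))
        (fun m => ampA (0 : Fin D → ℂ) v m.1) (fun m => ampμ (0 : Fin D → ℂ) v m.1)
        (ampA (0 : Fin D → ℂ) v (0 : TorusSite D N)) (ampμ (0 : Fin D → ℂ) v (0 : TorusSite D N))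
        (fun κ => v (Sum.inr (Sum.inr κ))) c := by
  rw [fibreFun_eq_iff_rows]
  rw [forall_congr' fun κ => EL_iff (0 : Fin D → ℂ) v r κ, G_iff (0 : Fin D → ℂ) v r, M_iff (0 : Fin D → ℂ) v r, forall_congr' fun κ => Q_iff (0 : Fin D → ℂ) v r κ]
  simp only [ArrowSolves0, ELRows, GRows, aliasFibre0]
  -- split every `∀ m` / `Σ_m` at the zero alias and simplify the zero-alias symbols
  have hEL0 : ∀ κ, ((2 * (lapSym (kFine (0 : Fin D → ℂ) (0 : TorusSite D N)) * ampA (0 : Fin D → ℂ) v (0 : TorusSite D N) κ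
        - dhat (kFine (0 : Fin D → ℂ) (0 : TorusSite D N)) κ * dot (dflat (kFine (0 : Fin D → ℂ) (0 : TorusSite D N))) (ampA (0 : Fin D → ℂ) v (0 : TorusSite D N)))
        - lapSym (kFine (0 : Fin D → ℂ) (0 : TorusSite D N)) * dhat (kFine (0 : Fin D → ℂ) (0 : TorusSite D N)) κ * ampμ (0 : Fin D → ℂ) v (0 : TorusSite D N))
        - chiHat (0 : Fin D → ℂ) (0 : TorusSite D N) * sflat (0 : Fin D → ℂ) (0 : TorusSite D N) κ * v (Sum.inr (Sum.inr κ)) = srcEL (0 : Fin D → ℂ) r (0 : TorusSite D N) κ)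
      ↔ -((N : ℂ) * v (Sum.inr (Sum.inr κ))) = srcEL (0 : Fin D → ℂ) r (0 : TorusSite D N) κ := by
    intro κ
    rw [kFine_zero_zero, lapSym_zero, dhat_zero, chiHat_zero_zero, sflat_zero_zero]
    constructor <;> intro h <;> linear_combination h
  have hG0 : ∀ c : ℂ, (lapSym (kFine (0 : Fin D → ℂ) (0 : TorusSite D N)) * dot (dflat (kFine (0 : Fin D → ℂ) (0 : TorusSite D N))) (ampA (0 : Fin D → ℂ) v (0 : TorusSite D N))
        - chiHat (0 : Fin D → ℂ) (0 : TorusSite D N) * c = srcG (0 : Fin D → ℂ) r (0 : TorusSite D N)) ↔ -(1 * c) = srcG (0 : Fin D → ℂ) r (0 : TorusSite D N) := by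
    intro c
    rw [kFine_zero_zero, lapSym_zero, chiHat_zero_zero]
    constructor <;> intro h <;> linear_combination h
  have hM0 : (∑ m : TorusSite D N, boxS (0 : Fin D → ℂ) m * ampμ (0 : Fin D → ℂ) v m = r (Sum.inr (Sum.inl 0)))
      ↔ (N : ℂ) ^ D * ampμ (0 : Fin D → ℂ) v (0 : TorusSite D N) + ∑ m : {m : TorusSite D N // m ≠ 0}, boxS (0 : Fin D → ℂ) m.1 * ampμ (0 : Fin D → ℂ) v m.1 = r (Sum.inr (Sum.inl 0)) := by
    rw [sum_torus_eq, boxS_zero_zero]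
  have hQ0 : ∀ κ, (∑ m : TorusSite D N, boxSs (0 : Fin D → ℂ) m κ * ampA (0 : Fin D → ℂ) v m κ = r (Sum.inr (Sum.inr κ)))
      ↔ (N : ℂ) ^ (D + 1) * ampA (0 : Fin D → ℂ) v (0 : TorusSite D N) κ + ∑ m : {m : TorusSite D N // m ≠ 0}, boxSs (0 : Fin D → ℂ) m.1 κ * ampA (0 : Fin D → ℂ) v m.1 κ = r (Sum.inr (Sum.inr κ)) := by
    intro κ
    rw [sum_torus_eq, boxSs_zero_zero]
  constructor
  · rintro ⟨hEL, ⟨c, hG⟩, hM, hQ⟩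
    refine ⟨c, fun m κ => hEL κ m.1, fun m => hG m.1, fun κ => (hEL0 κ).mp (hEL κ 0), ?_, hM0.mp hM, fun κ => (hQ0 κ).mp (hQ κ)⟩
    exact (hG0 c).mp (hG 0)
  · rintro ⟨c, hEL, hG, hE0, hGz, hM, hQ⟩
    refine ⟨fun κ => forall_torus_iff.mpr ⟨(hEL0 κ).mpr (hE0 κ), fun m => hEL m κ⟩, ⟨c, forall_torus_iff.mpr ⟨(hG0 c).mpr hGz, hG⟩⟩,
      hM0.mpr hM, fun κ => (hQ0 κ).mpr (hQ κ)⟩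

end Summit.QuantumFields.BalabanUV.Beta.GAN24.FibreArrowBZ

end
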